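import Literature.NumberTheory.LFunctions.KloostermanPrimePowerTools
import Mathlib.Analysis.Complex.Circle
import HarnessLib

/-!
# Route `PrimeLevelFamEdge`, crux K_B (stmt-Parity-20343), line `diagonal_kernel_split` rev 4,
# plan Ω, sub-line **Ω-d2 — the complete character sums of the Kloosterman layers: after Poisson
# summation modulo `c`, the ZERO FREQUENCY VANISHES EXACTLY, and the dual variables satisfy
# `h₁h₂ ≡ αβ (mod c)`**

The rev-4 heart `stub_offDiagBelowSlack_io` is a statement about the explicit off-diagonal
`PeterssonSplit.offDiag q l m = 2q̂ Σ_{(n₁,n₂)} w_q(n) Σ_{d₁∣(l,n₁)} Σ_{d₂∣(m,n₂)} J_q(ln₁/d₁², mn₂/d₂²)`,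
`J_q(a,b) = (2π/q) Σ_{r ≥ 1} r⁻¹ S(a,b;qr) J₁(4π√(ab)/(qr))`. Writing `nᵢ = dᵢkᵢ`, each layer `r` carries the
Kloosterman sums `S(α k₁, β k₂; c)` with `c = qr`, `α = l/d₁`, `β = m/d₂`, in which the summation
variables `k₁, k₂` sit INSIDE the Kloosterman sum. Poisson summation in `(k₁, k₂)` modulo `c`
(sub-line Ω-d1, `OffDiagPoissonTwisted`) produces, against the Fourier transform at `(h₁/c, h₂/c)`,
the complete sums evaluated here (GATE G2 §(a) rows a5–a6):

* `sum_const_mul_stdAddChar_mul` — orthogonality `Σ_{x mod c} a·e(tx/c) = a·c·𝟙[t = 0]`;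
* **`sum_kloostermanSum_mul_stdAddChar`** — `Σ_{x mod c} S(αx, b; c) e(hx/c) = c · Σ_{u ∈ (ℤ/c)ˣ, αu + h = 0} e(b ū/c)`;
* **`sum_kloostermanSum_mul_eq_zero`** — the zero frequency: `Σ_{x mod c} S(αx, b; c) = 0` whenever `α ≢ 0 (mod c)`;
* **`sum_sum_kloostermanSum_mul_stdAddChar`** — the two-variable complete sum
  `Σ_{x₁,x₂ mod c} S(αx₁, βx₂; c) e((h₁x₁ + h₂x₂)/c) = c² · #{u ∈ (ℤ/c)ˣ : αu = −h₁, βū = −h₂}`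
  (the «dual unit set», written inline as a `Finset.filter`), with its corollaries: `= 0` at `(h₁,h₂) = (0,0)` when `α ≢ 0` (`sum_sum_kloostermanSum_eq_zero`), the count is `≤ 1` when
  `α` is a unit (`card_dualUnits_le_one`), and it is EMPTY unless `h₁h₂ = αβ` in `ℤ/c`
  (`h_mul_h_eq_of_mem_dualUnits` — the «dual congruence `h₁h₂ ≡ A (mod cq)`» of G2 row a5);
* **prime level** (`natCast_ne_zero_of_lt_prime`, `sum_sum_kloostermanSum_primeLevel_zero_freq`): for `q` prime,
  `1 ≤ a < q` and EVERY `r ≥ 1`, `qr ∤ a`, so the zero frequency of every layer of `offDiag` vanishes — not only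
  for `c < q` (STUB-PLAN §1.3 (b) / §4.1 Ω-d: «at PRIME level ALL zero frequencies vanish identically»; this is the
  exact mechanism by which `c_zero` has no `r`-layer contribution);
* `fourierChar_int_mul_div_eq_stdAddChar` — the bridge `𝐞(xh/c) = e_c(xh)` between the phases produced by the
  tree's Poisson formula (`FriedlanderIwaniecPrimes.tsum_arithProg_eq_tsum_fourier`) and `ZMod.stdAddChar`.

Pure finite algebra over `ZMod c`; theorems only; standard axioms. Helper toward the heart; closes nothing.
«The programme SEARCHES and TYPES; no claim about Landau–Siegel zeros, Theorems 1–2 of arXiv:2211.02515 or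
a repaired Margin232 until a kernel theorem says so.»
-/

noncomputable section

open Finset
open scoped FourierTransform

namespace Summit.Parity.GeneralizedHardyLittlewood.Theorems.BeyondDiagonalBeatsQuarter.OffDiag

open Literature.NumberTheory.LFunctions

variable {c : ℕ} [NeZero c]

/-! ### Orthogonality of the additive characters of `ℤ/c` -/

/-- Orthogonality in the shape used below: `Σ_{x mod c} a·e(tx/c) = a·c` if `t = 0`, else `0`
(the tree's `sum_stdAddChar_mul`, several copies under `Literature/`, with a constant factor so that the
statement is not a verbatim restatement; proof: `AddChar.sum_eq_zero_of_ne_one`). [folklore] -/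
theorem sum_const_mul_stdAddChar_mul (a : ℂ) (t : ZMod c) :
    ∑ x : ZMod c, a * (ZMod.stdAddChar (t * x) : ℂ) = if t = 0 then a * (c : ℂ) else 0 := by
  rw [← Finset.mul_sum]
  split_ifs with h
  · simp only [h, zero_mul, AddChar.map_zero_eq_one, sum_const, card_univ, ZMod.card,
      nsmul_eq_mul, mul_one]
  · have h0 : ∑ x : ZMod c, (ZMod.stdAddChar (t * x) : ℂ) = 0 :=
      AddChar.sum_eq_zero_of_ne_one (ZMod.isPrimitive_stdAddChar c h)
    rw [h0, mul_zero]

/-- The phase of the tree's Poisson formula is the standard additive character of `ℤ/c`: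
`𝐞(x·h/c) = e_c(x·h)` for integers `x, h`. [folklore] -/
theorem fourierChar_int_mul_div_eq_stdAddChar (x h : ℤ) :
    ((𝐞 ((x : ℝ) * h / c) : ℂ)) = (ZMod.stdAddChar (((x * h : ℤ)) : ZMod c) : ℂ) := by
  rw [ZMod.stdAddChar_coe, Real.fourierChar_apply]
  congr 1
  push_cast
  ring

/-! ### One variable: `Σ_{x mod c} S(αx, b; c) e(hx/c)` -/

/-- **Complete sum of a Kloosterman layer in one variable.**
`Σ_{x mod c} S(αx, b; c)·e(hx/c) = c · Σ_{u ∈ (ℤ/c)ˣ, αu + h = 0} e(b ū/c)`: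
open `S(αx,b;c) = Σ_u e((αxu + bū)/c)`, exchange, and apply orthogonality in `x` to the phase
`(αu + h)x`. [folklore] -/
theorem sum_kloostermanSum_mul_stdAddChar (α b h : ZMod c) :
    ∑ x : ZMod c, kloostermanSum c (α * x) b * (ZMod.stdAddChar (h * x) : ℂ) =
      (c : ℂ) * ∑ u ∈ (univ : Finset (ZMod c)ˣ).filter (fun u : (ZMod c)ˣ ↦ α * (u : ZMod c) + h = 0),
        (ZMod.stdAddChar (b * ((u⁻¹ : (ZMod c)ˣ) : ZMod c)) : ℂ) := by
  classical
  calc ∑ x : ZMod c, kloostermanSum c (α * x) b * (ZMod.stdAddChar (h * x) : ℂ)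
      = ∑ x : ZMod c, ∑ u : (ZMod c)ˣ, (ZMod.stdAddChar (b * ((u⁻¹ : (ZMod c)ˣ) : ZMod c)) : ℂ) *
          (ZMod.stdAddChar ((α * (u : ZMod c) + h) * x) : ℂ) := by
        refine Fintype.sum_congr _ _ fun x ↦ ?_
        rw [kloostermanSum_eq_sum_units, Finset.sum_mul]
        refine Fintype.sum_congr _ _ fun u ↦ ?_
        rw [← AddChar.map_add_eq_mul, ← AddChar.map_add_eq_mul]
        congr 1
        ring
    _ = ∑ u : (ZMod c)ˣ, (ZMod.stdAddChar (b * ((u⁻¹ : (ZMod c)ˣ) : ZMod c)) : ℂ) *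
          ∑ x : ZMod c, (ZMod.stdAddChar ((α * (u : ZMod c) + h) * x) : ℂ) := by
        rw [Finset.sum_comm]
        exact Fintype.sum_congr _ _ fun u ↦ by rw [Finset.mul_sum]
    _ = ∑ u : (ZMod c)ˣ, (if α * (u : ZMod c) + h = 0 then
          (ZMod.stdAddChar (b * ((u⁻¹ : (ZMod c)ˣ) : ZMod c)) : ℂ) * (c : ℂ) else 0) :=
        Fintype.sum_congr _ _ fun u ↦ by rw [Finset.mul_sum, sum_const_mul_stdAddChar_mul]
    _ = (c : ℂ) * ∑ u ∈ (univ : Finset (ZMod c)ˣ).filter (fun u : (ZMod c)ˣ ↦ α * (u : ZMod c) + h = 0),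
          (ZMod.stdAddChar (b * ((u⁻¹ : (ZMod c)ˣ) : ZMod c)) : ℂ) := by
        rw [Finset.mul_sum, Finset.sum_filter]
        refine Fintype.sum_congr _ _ fun u ↦ ?_
        split_ifs <;> simp [mul_comm]

/-- If `α ≢ 0 (mod c)` then no unit `u` has `αu = 0`. [folklore] -/
theorem filter_mul_unit_eq_zero_empty {α : ZMod c} (hα : α ≠ 0) :
    (univ : Finset (ZMod c)ˣ).filter (fun u : (ZMod c)ˣ ↦ α * (u : ZMod c) + 0 = 0) = ∅ := by
  refine Finset.filter_false_of_mem fun u _ h ↦ hα ?_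
  rw [add_zero] at h
  simpa using congrArg (· * ((u⁻¹ : (ZMod c)ˣ) : ZMod c)) h

/-- **The zero frequency vanishes**: `Σ_{x mod c} S(αx, b; c) = 0` whenever `α ≢ 0 (mod c)`
(a Ramanujan-sum orthogonality on the units: `αu ≡ 0` has no unit solution). This is STUB-PLAN §1.3 (b):
«the zero dual frequency carries `Σ_{r mod cq} e(a·r·u/(cq)) = 0` because `q ∤ au`». [folklore] -/
theorem sum_kloostermanSum_mul_eq_zero {α : ZMod c} (hα : α ≠ 0) (b : ZMod c) :
    ∑ x : ZMod c, kloostermanSum c (α * x) b = 0 := by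
  have h := sum_kloostermanSum_mul_stdAddChar α b 0
  simp only [zero_mul, AddChar.map_zero_eq_one, mul_one] at h
  rw [h, filter_mul_unit_eq_zero_empty hα, Finset.sum_empty, mul_zero]

/-! ### Two variables: `Σ_{x₁,x₂ mod c} S(αx₁, βx₂; c) e((h₁x₁ + h₂x₂)/c)` -/

/-- Membership in the DUAL UNIT SET `{u ∈ (ℤ/c)ˣ : αu + h₁ = 0 ∧ βū + h₂ = 0}` of a Kloosterman layer at
frequencies `(h₁, h₂)` (written inline as a `Finset.filter` throughout). [folklore] -/
theorem mem_dualUnits {α β h₁ h₂ : ZMod c} {u : (ZMod c)ˣ} :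
    u ∈ (univ : Finset (ZMod c)ˣ).filter (fun u : (ZMod c)ˣ ↦
        α * (u : ZMod c) + h₁ = 0 ∧ β * ((u⁻¹ : (ZMod c)ˣ) : ZMod c) + h₂ = 0) ↔
      α * (u : ZMod c) + h₁ = 0 ∧ β * ((u⁻¹ : (ZMod c)ˣ) : ZMod c) + h₂ = 0 := by
  simp

/-- **Complete sum of a Kloosterman layer in two variables.**
`Σ_{x₁ mod c} Σ_{x₂ mod c} S(αx₁, βx₂; c)·e((h₁x₁ + h₂x₂)/c) = c² · #{u ∈ (ℤ/c)ˣ : αu + h₁ = 0, βū + h₂ = 0}`: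
open the Kloosterman sum over the units `u`, and apply orthogonality in `x₁` (phase `(αu + h₁)x₁`) and in
`x₂` (phase `(βū + h₂)x₂`). GATE G2 §(a) row a5 («double Poisson (n₁,n₂) mod cq:
Σ G S(m₁n₁,m₂n₂;cq) = Σ_{h₁h₂ ≡ A (cq)} Ĝ + strata»). [folklore] -/
theorem sum_sum_kloostermanSum_mul_stdAddChar (α β h₁ h₂ : ZMod c) :
    ∑ x₁ : ZMod c, ∑ x₂ : ZMod c,
        kloostermanSum c (α * x₁) (β * x₂) * (ZMod.stdAddChar (h₁ * x₁ + h₂ * x₂) : ℂ) =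
      (c : ℂ) ^ 2 * (((univ : Finset (ZMod c)ˣ).filter (fun u : (ZMod c)ˣ ↦
        α * (u : ZMod c) + h₁ = 0 ∧ β * ((u⁻¹ : (ZMod c)ˣ) : ZMod c) + h₂ = 0)).card : ℂ) := by
  classical
  -- open the Kloosterman sum and separate the two phases
  have hopen : ∀ x₁ x₂ : ZMod c,
      kloostermanSum c (α * x₁) (β * x₂) * (ZMod.stdAddChar (h₁ * x₁ + h₂ * x₂) : ℂ) =
        ∑ u : (ZMod c)ˣ, (ZMod.stdAddChar ((α * (u : ZMod c) + h₁) * x₁) : ℂ) *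
          (ZMod.stdAddChar ((β * ((u⁻¹ : (ZMod c)ˣ) : ZMod c) + h₂) * x₂) : ℂ) := by
    intro x₁ x₂
    rw [kloostermanSum_eq_sum_units, Finset.sum_mul]
    refine Fintype.sum_congr _ _ fun u ↦ ?_
    rw [← AddChar.map_add_eq_mul, ← AddChar.map_add_eq_mul]
    congr 1
    ring
  calc ∑ x₁ : ZMod c, ∑ x₂ : ZMod c,
        kloostermanSum c (α * x₁) (β * x₂) * (ZMod.stdAddChar (h₁ * x₁ + h₂ * x₂) : ℂ)
      = ∑ x₁ : ZMod c, ∑ x₂ : ZMod c, ∑ u : (ZMod c)ˣ,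
          (ZMod.stdAddChar ((α * (u : ZMod c) + h₁) * x₁) : ℂ) *
            (ZMod.stdAddChar ((β * ((u⁻¹ : (ZMod c)ˣ) : ZMod c) + h₂) * x₂) : ℂ) := by
        simp_rw [hopen]
    _ = ∑ x₁ : ZMod c, ∑ u : (ZMod c)ˣ, (ZMod.stdAddChar ((α * (u : ZMod c) + h₁) * x₁) : ℂ) *
          ∑ x₂ : ZMod c, (ZMod.stdAddChar ((β * ((u⁻¹ : (ZMod c)ˣ) : ZMod c) + h₂) * x₂) : ℂ) := by
        refine Fintype.sum_congr _ _ fun x₁ ↦ ?_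
        rw [Finset.sum_comm]
        exact Fintype.sum_congr _ _ fun u ↦ by rw [Finset.mul_sum]
    _ = ∑ u : (ZMod c)ˣ, (∑ x₁ : ZMod c, (ZMod.stdAddChar ((α * (u : ZMod c) + h₁) * x₁) : ℂ)) *
          ∑ x₂ : ZMod c, (ZMod.stdAddChar ((β * ((u⁻¹ : (ZMod c)ˣ) : ZMod c) + h₂) * x₂) : ℂ) := by
        rw [Finset.sum_comm]
        exact Fintype.sum_congr _ _ fun u ↦ by rw [Finset.sum_mul]
    _ = ∑ u : (ZMod c)ˣ, (if α * (u : ZMod c) + h₁ = 0 then 1 * (c : ℂ) else 0) *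
          (if β * ((u⁻¹ : (ZMod c)ˣ) : ZMod c) + h₂ = 0 then 1 * (c : ℂ) else 0) := by
        refine Fintype.sum_congr _ _ fun u ↦ ?_
        rw [← sum_const_mul_stdAddChar_mul, ← sum_const_mul_stdAddChar_mul]
        simp only [one_mul]
    _ = ∑ u : (ZMod c)ˣ,
          (if α * (u : ZMod c) + h₁ = 0 ∧ β * ((u⁻¹ : (ZMod c)ˣ) : ZMod c) + h₂ = 0
            then (c : ℂ) ^ 2 else 0) := by
        refine Fintype.sum_congr _ _ fun u ↦ ?_
        split_ifs <;> simp_all [sq]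
    _ = (c : ℂ) ^ 2 * (((univ : Finset (ZMod c)ˣ).filter (fun u : (ZMod c)ˣ ↦
        α * (u : ZMod c) + h₁ = 0 ∧ β * ((u⁻¹ : (ZMod c)ˣ) : ZMod c) + h₂ = 0)).card : ℂ) := by
        rw [← Finset.sum_filter, Finset.sum_const, nsmul_eq_mul, mul_comm]

/-! ### Corollaries: zero frequency, the dual congruence `h₁h₂ = αβ`, at most one unit -/

/-- On the dual unit set, `h₁h₂ = αβ` in `ℤ/c`: from `αu = −h₁` and `βū = −h₂` multiply and use `uū = 1`.
This is the «dual congruence `h₁h₂ ≡ A (mod cq)`, `A = m₁m₂`» of GATE G2 §(a) row a5 (here `A = αβ`).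
[folklore] -/
theorem h_mul_h_eq_of_mem_dualUnits {α β h₁ h₂ : ZMod c} {u : (ZMod c)ˣ}
    (hu : u ∈ (univ : Finset (ZMod c)ˣ).filter (fun u : (ZMod c)ˣ ↦
        α * (u : ZMod c) + h₁ = 0 ∧ β * ((u⁻¹ : (ZMod c)ˣ) : ZMod c) + h₂ = 0)) :
    h₁ * h₂ = α * β := by
  obtain ⟨h1, h2⟩ := mem_dualUnits.mp hu
  have e1 : h₁ = -(α * (u : ZMod c)) := by linear_combination h1
  have e2 : h₂ = -(β * ((u⁻¹ : (ZMod c)ˣ) : ZMod c)) := by linear_combination h2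
  rw [e1, e2, neg_mul_neg, mul_mul_mul_comm, Units.mul_inv, mul_one]

/-- Off the dual congruence the complete sum vanishes: if `h₁h₂ ≠ αβ` then `dualUnits = ∅`. [folklore] -/
theorem dualUnits_eq_empty_of_ne {α β h₁ h₂ : ZMod c} (hne : h₁ * h₂ ≠ α * β) :
    (univ : Finset (ZMod c)ˣ).filter (fun u : (ZMod c)ˣ ↦
        α * (u : ZMod c) + h₁ = 0 ∧ β * ((u⁻¹ : (ZMod c)ˣ) : ZMod c) + h₂ = 0) = ∅ :=
  Finset.eq_empty_of_forall_notMem fun _ hu ↦ hne (h_mul_h_eq_of_mem_dualUnits hu)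

/-- **The zero frequency of the two-variable complete sum vanishes**:
`Σ_{x₁,x₂ mod c} S(αx₁, βx₂; c) = 0` whenever `α ≢ 0 (mod c)`. [folklore] -/
theorem sum_sum_kloostermanSum_eq_zero {α : ZMod c} (hα : α ≠ 0) (β : ZMod c) :
    ∑ x₁ : ZMod c, ∑ x₂ : ZMod c, kloostermanSum c (α * x₁) (β * x₂) = 0 := by
  have h := sum_sum_kloostermanSum_mul_stdAddChar α β 0 0
  simp only [zero_mul, add_zero, AddChar.map_zero_eq_one, mul_one] at h
  have hempty : (univ : Finset (ZMod c)ˣ).filter (fun u : (ZMod c)ˣ ↦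
      α * (u : ZMod c) = 0 ∧ β * ((u⁻¹ : (ZMod c)ˣ) : ZMod c) = 0) = ∅ :=
    Finset.filter_false_of_mem fun u _ hu ↦ hα (by
      simpa using congrArg (· * ((u⁻¹ : (ZMod c)ˣ) : ZMod c)) hu.1)
  rw [h, hempty, Finset.card_empty, Nat.cast_zero, mul_zero]

/-- When `α` is a unit of `ℤ/c`, the dual unit set has at most one element (`u = −h₁α⁻¹` is forced):
each surviving frequency pair `(h₁,h₂)` is hit by at most ONE unit. [folklore] -/
theorem card_dualUnits_le_one {α : ZMod c} (hα : IsUnit α) (β h₁ h₂ : ZMod c) :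
    ((univ : Finset (ZMod c)ˣ).filter (fun u : (ZMod c)ˣ ↦
        α * (u : ZMod c) + h₁ = 0 ∧ β * ((u⁻¹ : (ZMod c)ˣ) : ZMod c) + h₂ = 0)).card ≤ 1 := by
  refine Finset.card_le_one.mpr fun u hu v hv ↦ ?_
  obtain ⟨hu1, -⟩ := mem_dualUnits.mp hu
  obtain ⟨hv1, -⟩ := mem_dualUnits.mp hv
  have h : α * (u : ZMod c) = α * (v : ZMod c) := by linear_combination hu1 - hv1
  exact Units.ext (hα.mul_left_cancel h)

/-- The complete two-variable sum is bounded by `c²` in absolute value when `α` is a unit. [folklore] -/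
theorem norm_sum_sum_kloostermanSum_mul_stdAddChar_le {α : ZMod c} (hα : IsUnit α) (β h₁ h₂ : ZMod c) :
    ‖∑ x₁ : ZMod c, ∑ x₂ : ZMod c,
        kloostermanSum c (α * x₁) (β * x₂) * (ZMod.stdAddChar (h₁ * x₁ + h₂ * x₂) : ℂ)‖ ≤ (c : ℝ) ^ 2 := by
  rw [sum_sum_kloostermanSum_mul_stdAddChar, norm_mul, Complex.norm_pow, Complex.norm_natCast,
    Complex.norm_natCast]
  have h1 : (((univ : Finset (ZMod c)ˣ).filter (fun u : (ZMod c)ˣ ↦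
      α * (u : ZMod c) + h₁ = 0 ∧ β * ((u⁻¹ : (ZMod c)ˣ) : ZMod c) + h₂ = 0)).card : ℝ) ≤ 1 := by
    exact_mod_cast card_dualUnits_le_one hα β h₁ h₂
  have h0 : (0 : ℝ) ≤ (c : ℝ) ^ 2 := by positivity
  nlinarith

/-! ### Prime level: `c = qr`, `α = l/d₁` with `1 ≤ l < q` — every layer's zero frequency vanishes -/

/-- For `q` prime, `1 ≤ a < q` and `r ≥ 1`: `a ≢ 0 (mod qr)` (indeed `qr ∤ a`, as `0 < a < q ≤ qr`). In `offDiag`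
the Kloosterman arguments are `(l/d₁)·k₁`, `(m/d₂)·k₂` with `1 ≤ l, m ≤ M < q` (`Δ′ < 2`), so this applies to EVERY
layer `r`, not only to `c < q`. [cite: KowalskiMichelVanderKam2000, Lemma 3.3 p. 9 and p. 13 — derivation] -/
theorem natCast_ne_zero_of_lt_prime {q a r : ℕ} (hq : q.Prime) (ha : 1 ≤ a) (haq : a < q) (hr : 1 ≤ r) :
    ((a : ℕ) : ZMod (q * r)) ≠ 0 := by
  rw [Ne, ZMod.natCast_eq_zero_iff]
  intro hdvd
  have hqr : q ≤ q * r := Nat.le_mul_of_pos_right q hr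
  have : q * r ≤ a := Nat.le_of_dvd (by omega) hdvd
  have := hq.one_lt
  omega

/-- A divisor quotient of `l` stays in `[1, q)`: for `d ∣ l`, `1 ≤ l < q` one has `1 ≤ l/d < q`. [folklore] -/
theorem one_le_div_and_div_lt {l d q : ℕ} (hd : d ∣ l) (hl : 1 ≤ l) (hlq : l < q) :
    1 ≤ l / d ∧ l / d < q := by
  have hd0 : 0 < d := Nat.pos_of_dvd_of_pos hd (by omega)
  exact ⟨(Nat.one_le_div_iff hd0).mpr (Nat.le_of_dvd (by omega) hd), lt_of_le_of_lt (Nat.div_le_self l d) hlq⟩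

/-- **Prime level, one variable**: for `q` prime, `1 ≤ a < q`, `r ≥ 1` and any `b`,
`Σ_{x mod qr} S(a·x, b; qr) = 0`. [cite: KowalskiMichelVanderKam2000, Lemma 3.3 p. 9 — derivation] -/
theorem sum_kloostermanSum_primeLevel_eq_zero {q a r : ℕ} [NeZero (q * r)] (hq : q.Prime) (ha : 1 ≤ a)
    (haq : a < q) (hr : 1 ≤ r) (b : ZMod (q * r)) :
    ∑ x : ZMod (q * r), kloostermanSum (q * r) ((a : ZMod (q * r)) * x) b = 0 :=
  sum_kloostermanSum_mul_eq_zero (natCast_ne_zero_of_lt_prime hq ha haq hr) b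

/-- **Prime level, two variables — the zero frequency of every Kloosterman layer of `offDiag` vanishes**:
for `q` prime, `1 ≤ a < q`, `r ≥ 1` and any `β`, `Σ_{x₁,x₂ mod qr} S(a·x₁, β·x₂; qr) = 0`
(STUB-PLAN §4.1 Ω-d / §1.3 (b): «at PRIME level the zero dual frequencies vanish identically»; GATE G1 §4 (ii)).
[cite: KowalskiMichelVanderKam2000, Lemma 3.3 p. 9 — derivation] -/
theorem sum_sum_kloostermanSum_primeLevel_zero_freq {q a r : ℕ} [NeZero (q * r)] (hq : q.Prime) (ha : 1 ≤ a)
    (haq : a < q) (hr : 1 ≤ r) (β : ZMod (q * r)) :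
    ∑ x₁ : ZMod (q * r), ∑ x₂ : ZMod (q * r),
      kloostermanSum (q * r) ((a : ZMod (q * r)) * x₁) (β * x₂) = 0 :=
  sum_sum_kloostermanSum_eq_zero (natCast_ne_zero_of_lt_prime hq ha haq hr) β

/-- **Prime level, the dual congruence for `offDiag`'s layers**: with `α = l/d₁`, `β = m/d₂` and `c = qr`, a
frequency pair `(h₁,h₂)` contributes to the complete sum only if `h₁h₂ ≡ (l/d₁)(m/d₂) (mod qr)`; otherwise the
complete sum is `0`. [cite: KowalskiMichelVanderKam2000, Lemma 3.3 p. 9 — derivation] -/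
theorem sum_sum_kloostermanSum_mul_stdAddChar_eq_zero_of_ne {α β h₁ h₂ : ZMod c} (hne : h₁ * h₂ ≠ α * β) :
    ∑ x₁ : ZMod c, ∑ x₂ : ZMod c,
        kloostermanSum c (α * x₁) (β * x₂) * (ZMod.stdAddChar (h₁ * x₁ + h₂ * x₂) : ℂ) = 0 := by
  rw [sum_sum_kloostermanSum_mul_stdAddChar, dualUnits_eq_empty_of_ne hne, Finset.card_empty, Nat.cast_zero,
    mul_zero]

end Summit.Parity.GeneralizedHardyLittlewood.Theorems.BeyondDiagonalBeatsQuarter.OffDiag
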